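import Mathlib.Tactic
import HarnessLib

/-!
# The HUB ROUTING of the `(111)`-films, XXVI-X: the ZONE-FREE table language — patterns, atoms, formulas, boxes

builds on p205010 (kernel theorem, internal audit signed; external expert review pending) — NOT used in this file.  Lane `prim-bschramm`, seat
`prim-bschramm-p2` (gen 37; class C1b; memo `HOME/bschramm/P2-LATTICES.md` §135); helper file (`--supports stmt-CriticalPhenomena-4575 --as helper`).

The small-`k` dispatcher of gen 37 places the hub next to the terminal `E₁` (no terminal-free zone, cf. «Slab111HubZone»); an entry is then
valid or not according to the LEVEL PATTERN of the configuration `(n₁, n₂, n₃, k)`: the pairwise level differences clamped at `±M` and the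
distances of each terminal to the two boundary levels clamped at `B` (§1, `Pat`, `patOf`).  Validity conditions are Boolean FORMULAS (§3, a fixed
four-level and/or normal form `Fm` over ATOMS, §2) whose atoms are SOUND one-sided tests on a single pattern coordinate (`Atom.eval`; soundness
`Atom.sound_*`: a true atom implies the corresponding fact about the real levels).  §4: BOXES of patterns (an interval per coordinate) and the
sufficient tests `Fm.trueOn` / `Fm.falseOn` for a formula to hold / fail on a whole box, with soundness — the leaf checks of the decision trees of
«Slab111HubXTree».  Constants: `M = 13`, `B = 9` (`XM`, `XB`).
[cite: DuminilCopinSidoraviciusTassion2016, §2.3 (proof of Fact 2: the three disjoint paths γ_u, γ_v, γ_w in B_R(z))]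
-/

namespace Summit.CriticalPhenomena.PercolationContinuityZ3.Theorems.Transplant

namespace Slab111

/-! ## §1 Patterns -/

/-- The clamp bound of the level differences. [folklore] -/
def XM : ℤ := 13
/-- The clamp bound of the boundary distances. [folklore] -/
def XB : ℤ := 9

/-- Clamping to `[−m, m]`. [folklore] -/
def clampZ (m x : ℤ) : ℤ := max (-m) (min m x)

/-- **The level pattern** of a configuration: `cIJ = clamp_M (n_J − n_I)`, `bI = min B n_I`, `tI = min B (k − n_I)`. [folklore] -/
structure Pat where
  (c12 c13 c23 b1 t1 b2 t2 b3 t3 : ℤ)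
  deriving DecidableEq, Repr

/-- Coordinate access: `0..8 = c12 c13 c23 b1 t1 b2 t2 b3 t3` (anything else reads `0`). [folklore] -/
def Pat.get (p : Pat) (i : ℕ) : ℤ :=
  match i with
  | 0 => p.c12 | 1 => p.c13 | 2 => p.c23 | 3 => p.b1 | 4 => p.t1 | 5 => p.b2 | 6 => p.t2 | 7 => p.b3 | 8 => p.t3 | _ => 0

/-- **The pattern of a configuration** `(n₁, n₂, n₃, k)`. [folklore] -/
def patOf (n₁ n₂ n₃ k : ℤ) : Pat :=
  ⟨clampZ XM (n₂ - n₁), clampZ XM (n₃ - n₁), clampZ XM (n₃ - n₂), min XB n₁, min XB (k - n₁), min XB n₂, min XB (k - n₂), min XB n₃, min XB (k - n₃)⟩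

/-- The real quantity behind coordinate `i`: the level difference or boundary distance. [folklore] -/
def realOf (n₁ n₂ n₃ k : ℤ) (i : ℕ) : ℤ :=
  match i with
  | 0 => n₂ - n₁ | 1 => n₃ - n₁ | 2 => n₃ - n₂ | 3 => n₁ | 4 => k - n₁ | 5 => n₂ | 6 => k - n₂ | 7 => n₃ | 8 => k - n₃ | _ => 0

/-- Difference coordinates (`i ≤ 2`) are clamped at `M`, boundary coordinates (`3 ≤ i ≤ 8`) at `B` from above. [folklore] -/
theorem patOf_get (n₁ n₂ n₃ k : ℤ) (i : ℕ) (hi : i ≤ 8) :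
    (patOf n₁ n₂ n₃ k).get i = if i ≤ 2 then clampZ XM (realOf n₁ n₂ n₃ k i) else min XB (realOf n₁ n₂ n₃ k i) := by
  interval_cases i <;> rfl

/-! ## §2 Atoms: sound one-sided tests on one coordinate -/

/-- Atom kinds.  On a difference coordinate (real value `d`): `dgt x` — surely `d > x`; `dlt x` — surely `d < x`.  On a bottom-distance
coordinate (real value `n ≥ 0`): `bge x` — `n + x ≥ 0`; `bne0 x` — `n + x ≠ 0`; `beq0 x` — `n + x = 0`.  On a top-distance coordinate
(real value `k − n ≥ 0`): `tle x` — `n + x ≤ k`; `tnek x` — `n + x ≠ k`; `teqk x` — `n + x = k`. [folklore] -/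
inductive AKind
  | dgt | dlt | bge | bne0 | beq0 | tle | tnek | teqk
  deriving DecidableEq, Repr

/-- An atom: coordinate, kind, constant. [folklore] -/
structure Atom where
  (i : ℕ) (kd : AKind) (x : ℤ)
  deriving DecidableEq, Repr

/-- **Evaluation of an atom at a coordinate value** `v`. [folklore] -/
def Atom.evalV (a : Atom) (v : ℤ) : Bool :=
  match a.kd with
  | .dgt => decide ((-XM < v ∧ v < XM ∧ a.x < v) ∨ (v = XM ∧ a.x < XM))
  | .dlt => decide ((-XM < v ∧ v < XM ∧ v < a.x) ∨ (v = -XM ∧ -XM < a.x))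
  | .bge => decide (0 ≤ v + a.x)
  | .bne0 => decide ((v < XB ∧ v + a.x ≠ 0) ∨ (v = XB ∧ 0 < XB + a.x))
  | .beq0 => decide (v < XB ∧ v + a.x = 0)
  | .tle => decide (a.x ≤ v)
  | .tnek => decide ((v < XB ∧ v ≠ a.x) ∨ (v = XB ∧ a.x < XB))
  | .teqk => decide (v < XB ∧ v = a.x)

/-- Evaluation of an atom at a pattern. [folklore] -/
def Atom.eval (p : Pat) (a : Atom) : Bool := a.evalV (p.get a.i)

/-- **The meaning of an atom** for the real quantity `r` behind its coordinate (`r = d`, `n` or `k − n`); for the top-distance kinds the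
statement is phrased with `r = k − n`. [folklore] -/
def Atom.Means (a : Atom) (r : ℤ) : Prop :=
  match a.kd with
  | .dgt => a.x < r
  | .dlt => r < a.x
  | .bge => 0 ≤ r + a.x
  | .bne0 => r + a.x ≠ 0
  | .beq0 => r + a.x = 0
  | .tle => a.x ≤ r
  | .tnek => r ≠ a.x
  | .teqk => r = a.x

/-- **Soundness of the difference atoms**: evaluated at `clamp_M d` they imply their meaning for `d`. [folklore] -/
theorem Atom.sound_diff (a : Atom) (hk : a.kd = .dgt ∨ a.kd = .dlt) (d : ℤ) (h : a.evalV (clampZ XM d) = true) : a.Means d := by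
  unfold Atom.evalV at h; unfold Atom.Means
  rcases hk with e | e <;> rw [e] at h ⊢ <;> simp only [decide_eq_true_eq] at h <;> unfold clampZ XM at h <;> omega

/-- **Soundness of the bottom-distance atoms**: evaluated at `min B n` (`n ≥ 0`) they imply their meaning for `n`. [folklore] -/
theorem Atom.sound_bot (a : Atom) (hk : a.kd = .bge ∨ a.kd = .bne0 ∨ a.kd = .beq0) {n : ℤ} (hn : 0 ≤ n)
    (h : a.evalV (min XB n) = true) : a.Means n := by
  unfold Atom.evalV at h; unfold Atom.Means
  rcases hk with e | e | e <;> rw [e] at h ⊢ <;> simp only [decide_eq_true_eq] at h <;> unfold XB at h <;> omega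

/-- **Soundness of the top-distance atoms**: evaluated at `min B (k − n)` (`n ≤ k`) they imply their meaning for `k − n`. [folklore] -/
theorem Atom.sound_top (a : Atom) (hk : a.kd = .tle ∨ a.kd = .tnek ∨ a.kd = .teqk) {n k : ℤ} (hn : n ≤ k)
    (h : a.evalV (min XB (k - n)) = true) : a.Means (k - n) := by
  unfold Atom.evalV at h; unfold Atom.Means
  rcases hk with e | e | e <;> rw [e] at h ⊢ <;> simp only [decide_eq_true_eq] at h <;> unfold XB at h <;> omega

/-- **A well-sorted atom**: difference kinds on coordinates `0–2`, bottom kinds on `3, 5, 7`, top kinds on `4, 6, 8`. [folklore] -/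
def Atom.ws (a : Atom) : Bool :=
  match a.kd with
  | .dgt | .dlt => decide (a.i ≤ 2)
  | .bge | .bne0 | .beq0 => decide (a.i = 3 ∨ a.i = 5 ∨ a.i = 7)
  | .tle | .tnek | .teqk => decide (a.i = 4 ∨ a.i = 6 ∨ a.i = 8)

/-- **Soundness of a well-sorted atom at the pattern of a configuration** (`0 ≤ nᵢ ≤ k`): its meaning holds for the real quantity behind its
coordinate. [folklore] -/
theorem Atom.sound (a : Atom) (hws : a.ws = true) {n₁ n₂ n₃ k : ℤ} (h1 : 0 ≤ n₁ ∧ n₁ ≤ k) (h2 : 0 ≤ n₂ ∧ n₂ ≤ k) (h3 : 0 ≤ n₃ ∧ n₃ ≤ k)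
    (h : a.eval (patOf n₁ n₂ n₃ k) = true) : a.Means (realOf n₁ n₂ n₃ k a.i) := by
  unfold Atom.eval at h
  unfold Atom.ws at hws
  cases hkd : a.kd <;> rw [hkd] at hws <;> simp only [decide_eq_true_eq] at hws
  · rw [patOf_get _ _ _ _ _ (by omega), if_pos hws] at h; exact a.sound_diff (by rw [hkd]; simp) _ h
  · rw [patOf_get _ _ _ _ _ (by omega), if_pos hws] at h; exact a.sound_diff (by rw [hkd]; simp) _ h
  all_goals rcases hws with e | e | e <;> rw [e] at h ⊢ <;> rw [patOf_get _ _ _ _ _ (by omega)] at h <;> simp only [show ¬ (3:ℕ) ≤ 2 by omega,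
      show ¬ (4:ℕ) ≤ 2 by omega, show ¬ (5:ℕ) ≤ 2 by omega, show ¬ (6:ℕ) ≤ 2 by omega, show ¬ (7:ℕ) ≤ 2 by omega, show ¬ (8:ℕ) ≤ 2 by omega,
      if_false] at h <;> unfold realOf at h ⊢
  · exact a.sound_bot (by rw [hkd]; simp) h1.1 h
  · exact a.sound_bot (by rw [hkd]; simp) h2.1 h
  · exact a.sound_bot (by rw [hkd]; simp) h3.1 h
  · exact a.sound_bot (by rw [hkd]; simp) h1.1 h
  · exact a.sound_bot (by rw [hkd]; simp) h2.1 h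
  · exact a.sound_bot (by rw [hkd]; simp) h3.1 h
  · exact a.sound_bot (by rw [hkd]; simp) h1.1 h
  · exact a.sound_bot (by rw [hkd]; simp) h2.1 h
  · exact a.sound_bot (by rw [hkd]; simp) h3.1 h
  · exact a.sound_top (by rw [hkd]; simp) h1.2 h
  · exact a.sound_top (by rw [hkd]; simp) h2.2 h
  · exact a.sound_top (by rw [hkd]; simp) h3.2 h
  · exact a.sound_top (by rw [hkd]; simp) h1.2 h
  · exact a.sound_top (by rw [hkd]; simp) h2.2 h
  · exact a.sound_top (by rw [hkd]; simp) h3.2 h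
  · exact a.sound_top (by rw [hkd]; simp) h1.2 h
  · exact a.sound_top (by rw [hkd]; simp) h2.2 h
  · exact a.sound_top (by rw [hkd]; simp) h3.2 h

/-! ## §3 Formulas: the four-level and/or normal form -/

/-- **Formulas**: an AND of ORs of ANDs of ORs of atoms (every validity condition and rule of the dispatcher has this shape). [folklore] -/
abbrev Fm := List (List (List (List Atom)))

/-- Evaluation of a clause (OR of atoms). [folklore] -/
def evalC (p : Pat) (c : List Atom) : Bool := c.any (Atom.eval p)
/-- Evaluation of a cube (AND of clauses). [folklore] -/
def evalQ (p : Pat) (q : List (List Atom)) : Bool := q.all (evalC p)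
/-- Evaluation of a disjunction of cubes. [folklore] -/
def evalD (p : Pat) (d : List (List (List Atom))) : Bool := d.any (evalQ p)
/-- **Evaluation of a formula** at a pattern. [folklore] -/
def Fm.eval (p : Pat) (f : Fm) : Bool := f.all (evalD p)

/-- A formula is well-sorted when all its atoms are. [folklore] -/
def Fm.ws (f : Fm) : Bool := f.all fun d => d.all fun q => q.all fun c => c.all Atom.ws

/-! ## §4 Boxes and the interval tests -/

/-- **A box of patterns**: lower and upper bounds per coordinate (lists of length `9`; missing entries read `0`). [folklore] -/
structure Box where
  (lo hi : List ℤ)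
  deriving DecidableEq, Repr

/-- Membership of a pattern in a box. [folklore] -/
def Box.mem (bx : Box) (p : Pat) : Prop := ∀ i, i ≤ 8 → bx.lo.getD i 0 ≤ p.get i ∧ p.get i ≤ bx.hi.getD i 0

/-- All integers of `[lo, hi]` satisfy a Boolean test (vacuous when `hi < lo`). [folklore] -/
def allIn (lo hi : ℤ) (t : ℤ → Bool) : Bool := (List.range (hi - lo + 1).toNat).all fun j => t (lo + j)

/-- Soundness of `allIn`. [folklore] -/
theorem allIn_sound {lo hi : ℤ} {t : ℤ → Bool} (h : allIn lo hi t = true) {v : ℤ} (hlo : lo ≤ v) (hhi : v ≤ hi) : t v = true := by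
  unfold allIn at h
  rw [List.all_eq_true] at h
  have := h (v - lo).toNat (by rw [List.mem_range]; omega)
  rwa [Int.toNat_of_nonneg (by omega), add_sub_cancel] at this

/-- An atom holds at every value of its coordinate in the box. [folklore] -/
def Atom.trueOn (bx : Box) (a : Atom) : Bool := allIn (bx.lo.getD a.i 0) (bx.hi.getD a.i 0) a.evalV
/-- An atom fails at every value of its coordinate in the box. [folklore] -/
def Atom.falseOn (bx : Box) (a : Atom) : Bool := allIn (bx.lo.getD a.i 0) (bx.hi.getD a.i 0) fun v => !a.evalV v

/-- Sufficient test: the clause holds on the whole box (some atom holds throughout). [folklore] -/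
def trueOnC (bx : Box) (c : List Atom) : Bool := c.any (Atom.trueOn bx)
/-- Sufficient test: the clause fails on the whole box (every atom fails throughout). [folklore] -/
def falseOnC (bx : Box) (c : List Atom) : Bool := c.all (Atom.falseOn bx)
/-- Sufficient test: the cube holds on the whole box. [folklore] -/
def trueOnQ (bx : Box) (q : List (List Atom)) : Bool := q.all (trueOnC bx)
/-- Sufficient test: the cube fails on the whole box (some clause fails throughout). [folklore] -/
def falseOnQ (bx : Box) (q : List (List Atom)) : Bool := q.any (falseOnC bx)
/-- Sufficient test: the disjunction holds on the whole box. [folklore] -/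
def trueOnD (bx : Box) (d : List (List (List Atom))) : Bool := d.any (trueOnQ bx)
/-- Sufficient test: the disjunction fails on the whole box. [folklore] -/
def falseOnD (bx : Box) (d : List (List (List Atom))) : Bool := d.all (falseOnQ bx)
/-- **Sufficient test: the formula holds on the whole box.** [folklore] -/
def Fm.trueOn (bx : Box) (f : Fm) : Bool := f.all (trueOnD bx)
/-- **Sufficient test: the formula fails on the whole box** (some conjunct fails throughout). [folklore] -/
def Fm.falseOn (bx : Box) (f : Fm) : Bool := f.any (falseOnD bx)

/-- Soundness of `Atom.trueOn` (atoms on coordinates `≤ 8`). [folklore] -/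
theorem Atom.trueOn_sound {bx : Box} {a : Atom} (hi : a.i ≤ 8) (h : a.trueOn bx = true) {p : Pat} (hp : bx.mem p) : a.eval p = true :=
  allIn_sound h (hp a.i hi).1 (hp a.i hi).2

/-- Soundness of `Atom.falseOn`. [folklore] -/
theorem Atom.falseOn_sound {bx : Box} {a : Atom} (hi : a.i ≤ 8) (h : a.falseOn bx = true) {p : Pat} (hp : bx.mem p) : a.eval p = false := by
  have := allIn_sound h (hp a.i hi).1 (hp a.i hi).2
  simpa [Atom.eval] using this

/-- The coordinate of a well-sorted atom is `≤ 8`. [folklore] -/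
theorem Atom.i_le_of_ws {a : Atom} (h : a.ws = true) : a.i ≤ 8 := by
  unfold Atom.ws at h; cases hk : a.kd <;> rw [hk] at h <;> simp only [decide_eq_true_eq] at h <;> omega

/-- **Soundness of `Fm.trueOn`**: a well-sorted formula true on a box holds at every pattern of the box. [folklore] -/
theorem Fm.trueOn_sound {bx : Box} {f : Fm} (hws : f.ws = true) (h : f.trueOn bx = true) {p : Pat} (hp : bx.mem p) : f.eval p = true := by
  unfold Fm.trueOn at h; unfold Fm.eval; unfold Fm.ws at hws
  rw [List.all_eq_true] at h hws ⊢
  intro d hd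
  have h1 := h d hd; have w1 := hws d hd
  unfold trueOnD at h1; unfold evalD
  rw [List.any_eq_true] at h1 ⊢; rw [List.all_eq_true] at w1
  obtain ⟨q, hq, h2⟩ := h1
  refine ⟨q, hq, ?_⟩
  have w2 := w1 q hq
  unfold trueOnQ at h2; unfold evalQ
  rw [List.all_eq_true] at h2 w2 ⊢
  intro c hc
  have h3 := h2 c hc; have w3 := w2 c hc
  unfold trueOnC at h3; unfold evalC
  rw [List.any_eq_true] at h3 ⊢; rw [List.all_eq_true] at w3
  obtain ⟨a, ha, h4⟩ := h3
  exact ⟨a, ha, Atom.trueOn_sound (Atom.i_le_of_ws (w3 a ha)) h4 hp⟩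

/-- **Soundness of `Fm.falseOn`**: a well-sorted formula false on a box fails at every pattern of the box. [folklore] -/
theorem Fm.falseOn_sound {bx : Box} {f : Fm} (hws : f.ws = true) (h : f.falseOn bx = true) {p : Pat} (hp : bx.mem p) : f.eval p = false := by
  unfold Fm.falseOn at h; unfold Fm.eval; unfold Fm.ws at hws
  rw [List.all_eq_true] at hws
  rw [List.any_eq_true] at h
  obtain ⟨d, hd, h1⟩ := h
  have w1 := hws d hd
  rw [Bool.eq_false_iff, ne_eq, List.all_eq_true, not_forall]
  refine ⟨d, fun hcon => ?_⟩
  have hev := hcon hd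
  unfold falseOnD at h1; unfold evalD at hev
  rw [List.all_eq_true] at h1 w1; rw [List.any_eq_true] at hev
  obtain ⟨q, hq, h2⟩ := hev
  have h3 := h1 q hq; have w2 := w1 q hq
  unfold falseOnQ at h3; unfold evalQ at h2
  rw [List.any_eq_true] at h3; rw [List.all_eq_true] at h2 w2
  obtain ⟨c, hc, h4⟩ := h3
  have h5 := h2 c hc; have w3 := w2 c hc
  unfold falseOnC at h4; unfold evalC at h5
  rw [List.all_eq_true] at h4 w3; rw [List.any_eq_true] at h5
  obtain ⟨a, ha, h6⟩ := h5
  have := Atom.falseOn_sound (Atom.i_le_of_ws (w3 a ha)) (h4 a ha) hp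
  rw [this] at h6; exact Bool.false_ne_true h6

end Slab111

end Summit.CriticalPhenomena.PercolationContinuityZ3.Theorems.Transplant
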